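import Mathlib
import Summits.QuantumFields.BalabanUV.Beta.UnitLatticeWalkTerms

/-!
# `Summit.QuantumFields.BalabanUV.Beta.UnitLatticeOmegaTerms` — A3-loc-ω (I): the unit-lattice walk expansion for a
# WALK-DECOMPOSED kernel `K′ = Σ_ω K_ω` with local inverses built from the NEAR pieces only: the resummation identity
# `(1 + K′)·Ptot = 1 − Rem₂` with steps `((1_{ω near b})·H_bK_ω − K_ωH_b)·L_bH_b` (near ω: commutator; far ω: insertion),
# and the expansion `Ptot·Rem₂ⁿ = Σ_{b₀, (b_t,ω_t)_t} term` with supports and ADMISSIBLE CHAINS (one point per cube,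
# each entering the domain of the next kernel piece)

HONEST FRAMING (page 1 of everything in this cell).  Discharging `FlowStep.BetaPertH` would make Bałaban's ultraviolet
stability UNCONDITIONAL — a constructive-QFT result; NOT the continuum limit, NOT the Clay problem.  This module
discharges nothing of `BetaPertH`; [folklore] algebra, kernel-checked (unit `b2b-balaban-beta-d4-p3`, road P3, gen 4;
skeleton v1.9 §7.6 «A3-loc-ω»: the decoration attached to the K-WALK DOMAINS — what (iii)+(iv) did not yet cover).
WHY THIS SHAPE.  A term of the unit-lattice expansion must carry every decoration cell its factors depend on.  The local
inverse `L_b` is taken for `1 + Σ_{ω ∈ near b} K_ω` (pieces localised near the cube: dependence inside the blob, and the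
inverse stays ACCRETIVE because it is not decorated — skeleton §7.4 (iv)); the FAR pieces then do not enter any inverse:
they reappear as insertion steps `−K_ωH_b·L_bH_b`, small because far pieces are long.  No Neumann expansion of local
inverses, no near∕far words ((ii)'s `UnitLatticeNearFar.locInv_split` is thereby not needed on this route).
CONTEXT (located, not used): [II] = CMP **116** (1988) p. 3 (1.6)–(1.7) (`H = Σ_ω H_ω`, decoration by the cubes met by
the localisation domain of `ω`), p. 4 (kernels vanish unless both arguments lie in one component); [13] = CMP **99** (1985)
(3.107)–(3.108) p. 416.
HONEST DEPENDENCY: continuum YM on T⁴ ⇐ BetaPertH ∧ nine spine estimates (0/9 proved); BetaPertH ⇐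
(D1) ∧ (D4) ∧ CAP+tail; G-an2-4 gates asym, D1 and NE2/3/4.

CONTENTS (0 sorry).  §1 `pieceA`, `stepPiece`, `Rem₂`, `Ktot`, `Knear`; **`resummation_identity₂`**:
`(1 + Ktot K)·Ptot = 1 − Rem₂` from `Σh² = 1`, supports, `P_bL_b = L_b` and the NEAR local-inverse property
`P_b(1 + Knear b)P_b·L_b = P_b`.  §2 `genTerm` (head `P₀ b₀` times an ordered product of steps) and
**`sum_mul_sum_pow_eq`**: `(Σ_b P₀ b)·(Σ_c S c)ⁿ = Σ_{b₀}Σ_{c⃗ : Fin n → C} genTerm n b₀ c⃗`; `walkTermΩ` = the instance with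
steps indexed by `C = B × Ω`, `Ptot_mul_Rem₂_pow`.  §3 supports (`walkTermΩ_apply_eq_zero_of_row∕_of_col`), the recursive
admissibility predicate `AdmΩ` (`y₀ ∈ □̃_{b₀}`; `y_t ∈ □̃_{b_t}`; `y_{t−1} ∈ D_{ω_t}`) and **`exists_chain_of_walkTermΩ_ne_zero`**.
NOT HERE: the tube count for the full decoration (sibling `UnitLatticeOmegaTube`), the credit majorants and bounds
(`UnitLatticeOmegaPaths`), the `RowData` hand-off; any instance on Bałaban's operators.  NOT summit progress.
-/

open scoped BigOperators Matrix
open Finset Matrix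

namespace Summit.QuantumFields.BalabanUV.Beta.UnitLatticeOmegaTerms

open Summit.QuantumFields.BalabanUV.Beta.UnitLatticeWalkInversion
open Summit.QuantumFields.BalabanUV.Beta.UnitLatticeWalkTerms (headFactor)

noncomputable section

variable {Y : Type*} [Fintype Y] [DecidableEq Y] {B Ω : Type*}

/-! ## §1 Pieces, steps, and the resummation identity -/

/-- The STEP COEFFICIENT KERNEL of the piece `ω` at the cube `b`: `1_{ω ∈ near b}·H_bK_ω − K_ωH_b` (near pieces: the
commutator `[H_b, K_ω]`; far pieces: the insertion `−K_ωH_b`). [folklore] -/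
def pieceA [DecidableEq Ω] (h : B → Y → ℝ) (K : Ω → Matrix Y Y ℂ) (near : B → Finset Ω) (b : B) (ω : Ω) :
    Matrix Y Y ℂ :=
  (if ω ∈ near b then Hd h b * K ω else 0) - K ω * Hd h b

/-- Entries of the step coefficient kernel: `((1_{near}·h_b(k)) − h_b(l))·K_ω(k,l)`. [folklore] -/
theorem pieceA_apply [DecidableEq Ω] (h : B → Y → ℝ) (K : Ω → Matrix Y Y ℂ) (near : B → Finset Ω) (b : B) (ω : Ω)
    (k l : Y) : pieceA h K near b ω k l = ((if ω ∈ near b then (h b k : ℂ) else 0) - (h b l : ℂ)) * K ω k l := by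
  unfold pieceA
  by_cases hω : ω ∈ near b
  · simp only [hω, if_true, Matrix.sub_apply, Hd, Matrix.diagonal_mul, Matrix.mul_diagonal]
    ring
  · simp only [hω, if_false, Matrix.sub_apply, Matrix.zero_apply, Hd, Matrix.mul_diagonal]
    ring

/-- The STEP of the expansion at `c = (b, ω)`: `pieceA b ω · (L_bH_b)`. [folklore] -/
def stepPiece [DecidableEq Ω] (h : B → Y → ℝ) (K : Ω → Matrix Y Y ℂ) (near : B → Finset Ω) (L : B → Matrix Y Y ℂ)
    (c : B × Ω) : Matrix Y Y ℂ :=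
  pieceA h K near c.1 c.2 * (L c.1 * Hd h c.1)

/-- The REMAINDER `Rem₂ = Σ_{(b,ω)} stepPiece (b,ω)`. [folklore] -/
def Rem₂ [Fintype B] [Fintype Ω] [DecidableEq Ω] (h : B → Y → ℝ) (K : Ω → Matrix Y Y ℂ) (near : B → Finset Ω)
    (L : B → Matrix Y Y ℂ) : Matrix Y Y ℂ :=
  ∑ c : B × Ω, stepPiece h K near L c

/-- The total kernel `K′ = Σ_ω K_ω`. [folklore] -/
def Ktot [Fintype Ω] (K : Ω → Matrix Y Y ℂ) : Matrix Y Y ℂ := ∑ ω, K ω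

/-- The NEAR kernel of the cube `b`: `Σ_{ω ∈ near b} K_ω`. [folklore] -/
def Knear (K : Ω → Matrix Y Y ℂ) (near : B → Finset Ω) (b : B) : Matrix Y Y ℂ := ∑ ω ∈ near b, K ω

/-- One cube: `(1 + K′)·(H L H) = H² − (H·Kn − K′·H)·(L H)` when `HP = H`, `PL = L` and `P(1 + Kn)P·L = P` (local inverse
for the NEAR kernel `Kn`). [folklore] -/
theorem one_add_mul_local₂ (K' Kn H P L : Matrix Y Y ℂ) (hHP : H * P = H) (hPL : P * L = L)
    (hinv : P * (1 + Kn) * P * L = P) :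
    (1 + K') * (H * L * H) = H * H - (H * Kn - K' * H) * (L * H) := by
  have hmid : H * (1 + Kn) * L * H = H * H := by
    calc H * (1 + Kn) * L * H = (H * P) * (1 + Kn) * (P * L) * H := by rw [hHP, hPL]
      _ = H * (P * (1 + Kn) * P * L) * H := by noncomm_ring
      _ = H * P * H := by rw [hinv]
      _ = H * H := by rw [hHP]
  calc (1 + K') * (H * L * H) = (H * (1 + Kn) * L * H - H * Kn * L * H) + K' * H * L * H := by noncomm_ring
    _ = H * H - (H * Kn - K' * H) * (L * H) := by rw [hmid]; noncomm_ring

/-- `H_b·Knear b − K′·H_b = Σ_ω pieceA b ω`. [folklore] -/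
theorem sub_eq_sum_pieceA [Fintype Ω] [DecidableEq Ω] (h : B → Y → ℝ) (K : Ω → Matrix Y Y ℂ) (near : B → Finset Ω)
    (b : B) : Hd h b * Knear K near b - Ktot K * Hd h b = ∑ ω, pieceA h K near b ω := by
  unfold pieceA Knear Ktot
  rw [Finset.sum_sub_distrib, Finset.sum_mul, Finset.mul_sum, Finset.sum_ite_mem, Finset.univ_inter]

/-- **THE RESUMMATION IDENTITY for the walk-decomposed kernel**: `(1 + K′)·Ptot = 1 − Rem₂`, from `Σ_b h_b² = 1`, supports
`supp h_b ⊆ □̃_b`, `P_bL_b = L_b`, and the NEAR local-inverse property `P_b(1 + Knear b)P_b·L_b = P_b`. [folklore] -/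
theorem resummation_identity₂ [Fintype B] [Fintype Ω] [DecidableEq Ω] (K : Ω → Matrix Y Y ℂ) (near : B → Finset Ω)
    (h : B → Y → ℝ) (E : B → Finset Y) (L : B → Matrix Y Y ℂ) (hsum : ∀ y, ∑ b, h b y ^ 2 = 1)
    (hsupp : ∀ b y, y ∉ E b → h b y = 0) (hPL : ∀ b, Pj E b * L b = L b)
    (hloc : ∀ b, Pj E b * (1 + Knear K near b) * Pj E b * L b = Pj E b) :
    (1 + Ktot K) * Ptot h L = 1 - Rem₂ h K near L := by
  unfold Ptot Rem₂
  rw [Finset.mul_sum, Fintype.sum_prod_type]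
  have hterm : ∀ b, (1 + Ktot K) * (Hd h b * L b * Hd h b)
      = Hd h b * Hd h b - ∑ ω, stepPiece h K near L (b, ω) := fun b => by
    rw [one_add_mul_local₂ (Ktot K) (Knear K near b) (Hd h b) (Pj E b) (L b) (Hd_mul_Pj h E hsupp b) (hPL b) (hloc b),
      sub_eq_sum_pieceA, Finset.sum_mul]
    rfl
  simp_rw [hterm]
  rw [Finset.sum_sub_distrib, sum_Hd_mul_Hd h hsum]

/-! ## §2 Ordered products over step sequences -/

/-- The GENERIC TERM: a head `P₀ b₀` times the ordered product of the steps `S (c⃗ 0) ⋯ S (c⃗ (n−1))` (recursion splitting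
off the last step). [folklore] -/
def genTerm {C : Type*} (P₀ : B → Matrix Y Y ℂ) (S : C → Matrix Y Y ℂ) : (n : ℕ) → B → (Fin n → C) → Matrix Y Y ℂ
  | 0, b₀, _ => P₀ b₀
  | n + 1, b₀, c => genTerm P₀ S n b₀ (Fin.init c) * S (c (Fin.last n))

/-- **`(Σ_b P₀ b)·(Σ_c S c)ⁿ = Σ_{b₀} Σ_{c⃗ : Fin n → C} genTerm n b₀ c⃗`** (noncommutative expansion of a power of a sum,
the head kept on the left). [folklore] -/
theorem sum_mul_sum_pow_eq [Fintype B] {C : Type*} [Fintype C] (P₀ : B → Matrix Y Y ℂ) (S : C → Matrix Y Y ℂ) :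
    ∀ n : ℕ, (∑ b, P₀ b) * (∑ c, S c) ^ n = ∑ b₀, ∑ c : Fin n → C, genTerm P₀ S n b₀ c
  | 0 => by simp [genTerm]
  | n + 1 => by
      rw [pow_succ, ← Matrix.mul_assoc, sum_mul_sum_pow_eq P₀ S n, Finset.sum_mul]
      refine Finset.sum_congr rfl fun b₀ _ => ?_
      rw [Finset.sum_mul_sum, ← Equiv.sum_comp (Fin.snocEquiv fun _ => C) (fun c' => genTerm P₀ S (n + 1) b₀ c'),
        Fintype.sum_prod_type, Finset.sum_comm]
      refine Finset.sum_congr rfl fun e _ => Finset.sum_congr rfl fun c _ => Eq.symm ?_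
      exact (by rw [genTerm, Fin.init_snoc, Fin.snoc_last] : genTerm P₀ S (n + 1) b₀ (Fin.snoc c e) = _)

/-- THE WALK TERM of the ω-expansion: head `H_{b₀}L_{b₀}H_{b₀}`, steps `stepPiece (b_t, ω_t)`. [folklore] -/
def walkTermΩ [DecidableEq Ω] (h : B → Y → ℝ) (K : Ω → Matrix Y Y ℂ) (near : B → Finset Ω) (L : B → Matrix Y Y ℂ) :
    (n : ℕ) → B → (Fin n → B × Ω) → Matrix Y Y ℂ :=
  genTerm (headFactor h L) (stepPiece h K near L)

/-- **THE EXPANSION**: `Ptot·Rem₂ⁿ = Σ_{b₀} Σ_{c⃗ : Fin n → B × Ω} walkTermΩ n b₀ c⃗`. [folklore] -/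
theorem Ptot_mul_Rem₂_pow [Fintype B] [Fintype Ω] [DecidableEq Ω] (h : B → Y → ℝ) (K : Ω → Matrix Y Y ℂ)
    (near : B → Finset Ω) (L : B → Matrix Y Y ℂ) (n : ℕ) :
    Ptot h L * Rem₂ h K near L ^ n = ∑ b₀, ∑ c : Fin n → B × Ω, walkTermΩ h K near L n b₀ c :=
  sum_mul_sum_pow_eq (headFactor h L) (stepPiece h K near L) n

/-! ## §3 Supports and admissible chains -/

section Supports

variable [DecidableEq Ω]

/-- The cube of the last factor of a term. [folklore] -/
def lastCube : (n : ℕ) → B → (Fin n → B × Ω) → B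
  | 0, b₀, _ => b₀
  | n + 1, _, c => (c (Fin.last n)).1

/-- Rows outside `□̃_{b₀}` vanish. [folklore] -/
theorem walkTermΩ_apply_eq_zero_of_row (h : B → Y → ℝ) (E : B → Finset Y) (hsupp : ∀ b y, y ∉ E b → h b y = 0)
    (K : Ω → Matrix Y Y ℂ) (near : B → Finset Ω) (L : B → Matrix Y Y ℂ) :
    ∀ (n : ℕ) (b₀ : B) (c : Fin n → B × Ω) (i j : Y), i ∉ E b₀ → walkTermΩ h K near L n b₀ c i j = 0
  | 0, b₀, c, i, j, hi => by
      show headFactor h L b₀ i j = 0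
      rw [headFactor, Matrix.mul_assoc, Hd, Matrix.diagonal_mul, hsupp _ _ hi]
      simp
  | n + 1, b₀, c, i, j, hi => by
      show (walkTermΩ h K near L n b₀ (Fin.init c) * stepPiece h K near L (c (Fin.last n))) i j = 0
      rw [Matrix.mul_apply]
      exact Finset.sum_eq_zero fun l _ => by
        rw [walkTermΩ_apply_eq_zero_of_row h E hsupp K near L n b₀ (Fin.init c) i l hi, zero_mul]

/-- Columns outside the cube of the last factor vanish (every factor ends with `H_b`). [folklore] -/
theorem walkTermΩ_apply_eq_zero_of_col (h : B → Y → ℝ) (E : B → Finset Y) (hsupp : ∀ b y, y ∉ E b → h b y = 0)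
    (K : Ω → Matrix Y Y ℂ) (near : B → Finset Ω) (L : B → Matrix Y Y ℂ) :
    ∀ (n : ℕ) (b₀ : B) (c : Fin n → B × Ω) (i j : Y), j ∉ E (lastCube n b₀ c) → walkTermΩ h K near L n b₀ c i j = 0
  | 0, b₀, c, i, j, hj => by
      have hj' : h b₀ j = 0 := hsupp _ _ hj
      show headFactor h L b₀ i j = 0
      rw [headFactor, Hd, Matrix.mul_diagonal, hj']
      simp
  | n + 1, b₀, c, i, j, hj => by
      have hj' : h (c (Fin.last n)).1 j = 0 := hsupp _ _ hj
      show (walkTermΩ h K near L n b₀ (Fin.init c) * stepPiece h K near L (c (Fin.last n))) i j = 0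
      rw [stepPiece, ← Matrix.mul_assoc, ← Matrix.mul_assoc, Hd, Matrix.mul_diagonal, hj']
      simp

/-- A nonzero entry of `pieceA b ω` lies in the DOMAIN of the piece: `K_ω(k,l) ≠ 0`. [folklore] -/
theorem K_ne_zero_of_pieceA_ne_zero (h : B → Y → ℝ) (K : Ω → Matrix Y Y ℂ) (near : B → Finset Ω) {b : B} {ω : Ω}
    {k l : Y} (hne : pieceA h K near b ω k l ≠ 0) : K ω k l ≠ 0 := fun h0 => hne (by rw [pieceA_apply, h0, mul_zero])

/-- ADMISSIBLE CHAINS of a term (recursive, as `genTerm`): one point per cube, `y₀ ∈ □̃_{b₀}`, `y_t ∈ □̃_{b_t}`, and the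
ENTRY CONDITION `y_{t−1} ∈ D_{ω_t}` (the previous point lies in the domain of the next kernel piece). [folklore] -/
def AdmΩ (E : B → Finset Y) (Dω : Ω → Finset Y) : (n : ℕ) → B → (Fin n → B × Ω) → (Fin (n + 1) → Y) → Prop
  | 0, b₀, _, y => y 0 ∈ E b₀
  | n + 1, b₀, c, y => AdmΩ E Dω n b₀ (Fin.init c) (Fin.init y) ∧ y (Fin.last n).castSucc ∈ Dω (c (Fin.last n)).2 ∧
      y (Fin.last (n + 1)) ∈ E (c (Fin.last n)).1

omit [Fintype Y] [DecidableEq Y] [DecidableEq Ω] in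
/-- Unfolding admissibility at a snoc-extended chain. [folklore] -/
theorem admΩ_snoc (E : B → Finset Y) (Dω : Ω → Finset Y) (n : ℕ) (b₀ : B) (c : Fin (n + 1) → B × Ω)
    (y : Fin (n + 1) → Y) (z : Y) :
    AdmΩ E Dω (n + 1) b₀ c (Fin.snoc y z) ↔
      AdmΩ E Dω n b₀ (Fin.init c) y ∧ y (Fin.last n) ∈ Dω (c (Fin.last n)).2 ∧ z ∈ E (c (Fin.last n)).1 := by
  rw [AdmΩ, Fin.init_snoc, Fin.snoc_castSucc, Fin.snoc_last]

omit [Fintype Y] [DecidableEq Y] [DecidableEq Ω] in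
/-- An admissible chain ends in the cube of the last factor. [folklore] -/
theorem AdmΩ.last_mem (E : B → Finset Y) (Dω : Ω → Finset Y) :
    ∀ {n : ℕ} {b₀ : B} {c : Fin n → B × Ω} {y : Fin (n + 1) → Y}, AdmΩ E Dω n b₀ c y →
      y (Fin.last n) ∈ E (lastCube n b₀ c)
  | 0, _, _, _, hy => hy
  | _ + 1, _, _, _, hy => hy.2.2

/-- **A nonzero entry `walkTermΩ n b₀ c⃗ (i,k)` is witnessed by an ADMISSIBLE CHAIN ending at `k`** (the right factors `H_b`
pin the points in the cubes; the coefficient kernels `pieceA` pin the previous point in the domain of the piece, given the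
block-locality `K_ω(k,l) ≠ 0 → k ∈ D_ω`). [folklore] -/
theorem exists_chain_of_walkTermΩ_ne_zero (h : B → Y → ℝ) (E : B → Finset Y) (hsupp : ∀ b y, y ∉ E b → h b y = 0)
    (K : Ω → Matrix Y Y ℂ) (Dω : Ω → Finset Y) (hK : ∀ ω k l, K ω k l ≠ 0 → k ∈ Dω ω) (near : B → Finset Ω)
    (L : B → Matrix Y Y ℂ) :
    ∀ (n : ℕ) (b₀ : B) (c : Fin n → B × Ω) (i k : Y), walkTermΩ h K near L n b₀ c i k ≠ 0 →
      ∃ y : Fin (n + 1) → Y, AdmΩ E Dω n b₀ c y ∧ y (Fin.last n) = k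
  | 0, b₀, c, i, k, hne => by
      have hk : k ∈ E b₀ :=
        by_contra fun hk => hne (walkTermΩ_apply_eq_zero_of_col h E hsupp K near L 0 b₀ c i k hk)
      exact ⟨fun _ => k, hk, rfl⟩
  | n + 1, b₀, c, i, m, hne => by
      have hm : m ∈ E (c (Fin.last n)).1 :=
        by_contra fun hm => hne (walkTermΩ_apply_eq_zero_of_col h E hsupp K near L (n + 1) b₀ c i m hm)
      have hne' : (walkTermΩ h K near L n b₀ (Fin.init c) * stepPiece h K near L (c (Fin.last n))) i m ≠ 0 := hne
      rw [Matrix.mul_apply] at hne'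
      obtain ⟨k, _, hk⟩ := Finset.exists_ne_zero_of_sum_ne_zero hne'
      have hT : walkTermΩ h K near L n b₀ (Fin.init c) i k ≠ 0 := fun h0 => hk (by rw [h0, zero_mul])
      have hS : stepPiece h K near L (c (Fin.last n)) k m ≠ 0 := fun h0 => hk (by rw [h0, mul_zero])
      rw [stepPiece, Matrix.mul_apply] at hS
      obtain ⟨l, _, hl⟩ := Finset.exists_ne_zero_of_sum_ne_zero hS
      have hA : pieceA h K near (c (Fin.last n)).1 (c (Fin.last n)).2 k l ≠ 0 := fun h0 => hl (by rw [h0, zero_mul])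
      have hkD : k ∈ Dω (c (Fin.last n)).2 := hK _ _ _ (K_ne_zero_of_pieceA_ne_zero h K near hA)
      obtain ⟨y, hy, hyk⟩ := exists_chain_of_walkTermΩ_ne_zero h E hsupp K Dω hK near L n b₀ (Fin.init c) i k hT
      refine ⟨Fin.snoc y m, ?_, Fin.snoc_last _ _⟩
      rw [admΩ_snoc]
      exact ⟨hy, hyk ▸ hkD, hm⟩

end Supports

end

end Summit.QuantumFields.BalabanUV.Beta.UnitLatticeOmegaTerms
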